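import Summits.CriticalPhenomena.CardyFormulaZ2.Theorems.CardySelfDualSegmentUniformMarginalityDefs
import Summits.CriticalPhenomena.CardyFormulaZ2.Theorems.CardyIKTransportCornerLineDescentFreezeContinuity

/-!
# The thinned collar-to-collar event of the centre is below the crude event of a close rectangle (sub-stub N3 of
`stub_fixedDomainContinuity_one`, line `Sketch`, crux `UniformMarginality`, stmt-CriticalPhenomena-5472)

`Freeze.lowerCrossing R κ ρ δ`: an open lattice path whose vertices have their closed `ρ`-balls inside
`Freeze.enlarge R κ = R.carrier ∪ collar₀ ∪ collar₂` (`Freeze.sideCollar R i κ` = points `κ`-close to `R.arc i` and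
`2κ`-far from the other three arcs), from a vertex whose `ρ`-ball lies in `collar₀ ∖ R.carrier` to one whose `ρ`-ball
lies in `collar₂ ∖ R.carrier`.  If `Q` is `η`-close to `R` (carrier in the `η`-fattening, `η`-deep points of `R` in
`Q`, arcs `η`-close both ways), `η < ρ` and `√2 δ + 3η ≤ κ`, then for lattice configurations this event is contained in
`crossEvent Q δ`.  Proof: every vertex of the walk lies in `Q.carrier` or in a TWO-RADIUS collar of `Q`
(`{p | infDist p (Q.arc i) < κ + η ∧ 2κ - 2η < infDist p (otherArcs Q i)}`, `i ∈ {0, 2}`), the endpoints in these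
collars and outside `Q.carrier`; then the run extraction of `Freeze.exists_crossing_run`, redone for two-radius
collars (points of the two collars are `> κ - 3η ≥ √2 δ` apart; a frontier point of `Q` within `√2 δ` of a collar-`i`
point lies on `Q.arc i`), yields a sub-walk inside `Q.carrier` from within one edge length `√2 δ ≤ 2δ` of `Q.arc 0`
to within `√2 δ` of `Q.arc 2`, i.e. a member of `crossEvent Q δ`.
-/

noncomputable section

namespace Summit.CriticalPhenomena.CardyFormulaZ2.Cruxes.UniformMarginality.HeatFlow

open Set Metric
open Literature.Probability.Percolation Literature.Probability.LatticeModels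
  Literature.Probability.RandomPlanarGeometry
open Summit.CriticalPhenomena.CardyFormulaZ2.Theorems.CornerLineDescent.SymmetricSeed

/-! ## Thickening bookkeeping -/

/-- Membership in a closed thickening bounds the distance to the set: `p ∈ cthickening η B` and `0 ≤ η` give
`infDist p B ≤ η` (if `B = ∅` the left side is `0`). -/
private theorem infDist_le_of_mem_cthickening' {p : ℂ} {B : Set ℂ} {η : ℝ} (hη : 0 ≤ η)
    (h : p ∈ Metric.cthickening η B) : Metric.infDist p B ≤ η :=
  ENNReal.toReal_le_of_le_ofReal hη (Metric.mem_cthickening_iff.1 h)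

/-- If a nonempty set `A` lies in the closed `η`-thickening of `B`, then the distance to `B` exceeds the distance
to `A` by at most `η`: `infDist p B ≤ infDist p A + η`. -/
private theorem infDist_le_infDist_add_of_subset_cthickening' {p : ℂ} {A B : Set ℂ} {η : ℝ} (hη : 0 ≤ η)
    (hA : A.Nonempty) (h : A ⊆ Metric.cthickening η B) : Metric.infDist p B ≤ Metric.infDist p A + η := by
  have key : Metric.infDist p B - η ≤ Metric.infDist p A := by
    rw [Metric.le_infDist hA]
    intro a ha
    have h1 : Metric.infDist a B ≤ η := infDist_le_of_mem_cthickening' hη (h ha)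
    have h2 : Metric.infDist p B ≤ Metric.infDist a B + dist p a := Metric.infDist_le_infDist_add_dist
    linarith
  linarith

/-! ## Two-radius collars of the marked arcs: the three geometric facts -/

/-- A point `a`-close to `arc i` and a point `b`-far from the arcs other than `arc j`, `j ≠ i`, are more than
`b - a` apart (two-radius version of `Freeze.lt_dist_of_mem_sideCollar`). -/
private theorem lt_dist_of_near_of_far {Q : ConformalRectangle} {i j : Fin 4} (h : i ≠ j) {a b : ℝ} {p q : ℂ}
    (hp : Metric.infDist p (Q.arc i) < a) (hq : b < Metric.infDist q (Freeze.otherArcs Q j)) :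
    b - a < dist p q := by
  have h3 := Freeze.infDist_otherArcs_le (R := Q) h q
  have h4 : Metric.infDist q (Q.arc i) ≤ Metric.infDist p (Q.arc i) + dist q p :=
    Metric.infDist_le_infDist_add_dist
  rw [dist_comm] at h4
  linarith

/-- No point is `a`-close to `arc i` and `b`-far from the arcs other than `arc j`, `j ≠ i`, when `a ≤ b`
(two-radius version of `Freeze.not_mem_sideCollar_of_mem`). -/
private theorem not_far_of_near {Q : ConformalRectangle} {i j : Fin 4} (h : i ≠ j) {a b : ℝ} (hab : a ≤ b)
    {p : ℂ} (hp : Metric.infDist p (Q.arc i) < a) : ¬ b < Metric.infDist p (Freeze.otherArcs Q j) := by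
  intro hq
  have h3 := Freeze.infDist_otherArcs_le (R := Q) h p
  linarith

/-- A frontier point within `b` of a point `b`-far from the arcs other than `arc i` lies on `arc i` (two-radius
version of `Freeze.mem_arc_of_mem_frontier`). -/
private theorem mem_arc_of_mem_frontier' {Q : ConformalRectangle} {i : Fin 4} {b : ℝ} {p w : ℂ}
    (hp : b < Metric.infDist p (Freeze.otherArcs Q i)) (hw : w ∈ frontier Q.carrier) (hd : dist p w ≤ b) :
    w ∈ Q.arc i := by
  rw [← (Q.iUnion_arc_holds : ⋃ k, Q.arc k = frontier Q.carrier)] at hw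
  obtain ⟨j, hj⟩ := Set.mem_iUnion.1 hw
  by_cases hji : j = i
  · exact hji ▸ hj
  · exfalso
    have h3 := Freeze.infDist_otherArcs_le (R := Q) hji p
    have h4 : Metric.infDist p (Q.arc j) ≤ dist p w := Metric.infDist_le_dist_of_mem hj
    linarith

/-- GEOMETRIC RUN EXTRACTION with abstract collars `C₀`, `C₂`.  Let the vertices of a graph be drawn in the plane
by `P` with edges of length `≤ ℓ`; assume points of `C₀` and `C₂` are more than `ℓ` apart, no point lies in both,
and a frontier point of `Ω` within `ℓ` of a point of `C₀` (`C₂`) lies on `arc 0` (`arc 2`).  A walk drawn inside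
`Ω ∪ C₀ ∪ C₂`, from a vertex drawn in `C₀ ∖ Ω` to a vertex drawn in `C₂ ∖ Ω`, contains a walk drawn inside `Ω`
from a vertex within `ℓ` of `arc 0` to a vertex within `ℓ` of `arc 2` (adapted from `Freeze.exists_crossing_run`). -/
private theorem exists_crossing_run' {V : Type*} {H : SimpleGraph V} (P : V → ℂ) {ℓ : ℝ}
    (hstep : ∀ x y, H.Adj x y → dist (P x) (P y) ≤ ℓ) (Q : ConformalRectangle) (C₀ C₂ : Set ℂ)
    (hsep : ∀ p ∈ C₀, ∀ q ∈ C₂, ℓ < dist p q) (hdisj : ∀ p ∈ C₀, p ∉ C₂)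
    (harc0 : ∀ p ∈ C₀, ∀ w ∈ frontier Q.carrier, dist p w ≤ ℓ → w ∈ Q.arc 0)
    (harc2 : ∀ p ∈ C₂, ∀ w ∈ frontier Q.carrier, dist p w ≤ ℓ → w ∈ Q.arc 2)
    {u v : V} (p : H.Walk u v) (hu : P u ∈ C₀ \ Q.carrier) (hv : P v ∈ C₂ \ Q.carrier)
    (hsupp : ∀ y ∈ p.support, P y ∈ Q.carrier ∪ C₀ ∪ C₂) :
    ∃ (x y : V) (q : H.Walk x y), (∀ z ∈ q.support, P z ∈ Q.carrier) ∧
      Metric.infDist (P x) (Q.arc 0) ≤ ℓ ∧ Metric.infDist (P y) (Q.arc 2) ≤ ℓ := by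
  obtain ⟨a', x, y, b', q, ha', hxa, hb', hyb, hq⟩ := Freeze.exists_run
    (fun z => P z ∈ C₀ \ Q.carrier) (fun z => P z ∈ C₂ \ Q.carrier) (fun z => P z ∈ Q.carrier ∪ C₀ ∪ C₂)
    (fun x y hx hy hxy => by
      have h1 := hsep _ hx.1 _ hy.1
      have h2 := hstep x y hxy
      linarith)
    (fun x hx hx' => hdisj _ hx.1 hx'.1) p hu hv hsupp
  have hin : ∀ z ∈ q.support, P z ∈ Q.carrier := by
    intro z hz
    obtain ⟨hg, h0, h2⟩ := hq z hz
    rcases hg with (h | h) | h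
    · exact h
    · by_contra hc; exact h0 ⟨h, hc⟩
    · by_contra hc; exact h2 ⟨h, hc⟩
  -- entering edge `a' — x` meets the frontier on `arc 0`, leaving edge `y — b'` on `arc 2`
  have key : ∀ {C : Set ℂ} {i : Fin 4}, (∀ p ∈ C, ∀ w ∈ frontier Q.carrier, dist p w ≤ ℓ → w ∈ Q.arc i) →
      ∀ {x' x : V}, P x' ∈ C \ Q.carrier → P x ∈ Q.carrier → H.Adj x' x →
        Metric.infDist (P x) (Q.arc i) ≤ ℓ := by
    intro C i harc x' x hx' hx hadj
    have hns : ¬ segment ℝ (P x) (P x') ⊆ Q.carrier := fun hs => hx'.2 (hs (right_mem_segment _ _ _))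
    obtain ⟨w, hw, hwf⟩ := Literature.Probability.Percolation.exists_mem_segment_frontier Q.isOpen hx hns
    have hd : dist (P x') (P x) ≤ ℓ := hstep _ _ hadj
    have hw1 : dist (P x') w ≤ ℓ :=
      (Metric.mem_closedBall'.1 (segment_subset_closedBall_right (P x) (P x') hw)).trans
        (dist_comm (P x) (P x') ▸ hd)
    have hw2 : dist (P x) w ≤ ℓ :=
      (Metric.mem_closedBall'.1 (segment_subset_closedBall_left (P x) (P x') hw)).trans
        (dist_comm (P x) (P x') ▸ hd)
    have hwarc : w ∈ Q.arc i := harc _ hx'.1 w hwf hw1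
    exact (Metric.infDist_le_dist_of_mem hwarc).trans hw2
  exact ⟨x, y, q, hin, key harc0 ha' (hin x q.start_mem_support) hxa,
    key harc2 hb' (hin y q.end_mem_support) hyb.symm⟩

/-! ## The stub -/

/-- SUB-STUB (N3) of `stub_fixedDomainContinuity_one`: **thinned collar-to-collar event of the centre ⊆ crude
event of a close rectangle** (lattice configurations). -/
theorem stub_lowerCrossing_subset_crossEvent_of_close :
    ∀ (R Q : ConformalRectangle) (η κ ρ δ : ℝ), 0 < δ → 0 ≤ η → η < ρ →
      Real.sqrt 2 * δ + 3 * η ≤ κ →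
      Q.carrier ⊆ Metric.cthickening η R.carrier →
      (∀ z ∈ R.carrier, (∀ w ∈ frontier R.carrier, η < dist z w) → z ∈ Q.carrier) →
      (∀ i : Fin 4, Q.arc i ⊆ Metric.cthickening η (R.arc i) ∧ R.arc i ⊆ Metric.cthickening η (Q.arc i)) →
      ∀ ω : BondConfig (Site 2), ω ⊆ (zdGraph 2).edgeSet →
        ω ∈ Freeze.lowerCrossing R κ ρ δ → ω ∈ crossEvent Q δ := by
  intro R Q η κ ρ δ hδ hη hηρ hκ hcar hdeep harcs ω hω h
  -- numerics
  have hρ : 0 ≤ ρ := hη.trans hηρ.le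
  have hs0 : 0 < Real.sqrt 2 * δ := mul_pos (Real.sqrt_pos.2 two_pos) hδ
  have h2le : Real.sqrt 2 * δ ≤ 2 * δ := by
    have : Real.sqrt 2 ≤ 2 := by
      rw [show (2:ℝ) = Real.sqrt 4 by rw [show (4:ℝ) = 2 ^ 2 by norm_num, Real.sqrt_sq zero_le_two]]
      exact Real.sqrt_le_sqrt (by norm_num)
    nlinarith
  -- (α): the arcs of `Q` are `η`-close to those of `R`; (β): the other arcs of `R` to those of `Q`
  have hα : ∀ (i : Fin 4) (x : ℂ), Metric.infDist x (Q.arc i) ≤ Metric.infDist x (R.arc i) + η :=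
    fun i x => infDist_le_infDist_add_of_subset_cthickening' hη ⟨R.pt i, R.pt_mem_arc_self i⟩ (harcs i).2
  have hne : ∀ i : Fin 4, i + 1 ≠ i := by decide
  have hβ : ∀ (i : Fin 4) (x : ℂ), Metric.infDist x (Freeze.otherArcs R i) ≤
      Metric.infDist x (Freeze.otherArcs Q i) + η := by
    intro i x
    refine infDist_le_infDist_add_of_subset_cthickening' hη
      ⟨Q.pt (i + 1), Freeze.arc_subset_otherArcs (hne i) (Q.pt_mem_arc_self (i + 1))⟩ ?_
    intro p hp
    simp only [Freeze.otherArcs, Set.mem_iUnion] at hp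
    obtain ⟨j, hj, hpj⟩ := hp
    exact Metric.cthickening_subset_of_subset η (Freeze.arc_subset_otherArcs hj) ((harcs j).1 hpj)
  -- one-radius collars of `R` lie in the two-radius collars
  -- `{x | infDist x (Q.arc i) < κ + η ∧ 2κ - 2η < infDist x (otherArcs Q i)}` of `Q`
  have hcollar : ∀ (i : Fin 4) (x : ℂ), x ∈ Freeze.sideCollar R i κ →
      Metric.infDist x (Q.arc i) < κ + η ∧ 2 * κ - 2 * η < Metric.infDist x (Freeze.otherArcs Q i) := by
    intro i x hx
    have h1 : Metric.infDist x (R.arc i) < κ := hx.1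
    have h2 : 2 * κ < Metric.infDist x (Freeze.otherArcs R i) := hx.2
    have h3 := hα i x
    have h4 := hβ i x
    constructor
    · linarith
    · linarith
  -- points within `η` of a frontier point of `R` lying in a collar of `R` are in the two-radius collar of `Q`
  have hnear : ∀ (i : Fin 4) (x w : ℂ), w ∈ Freeze.sideCollar R i κ → w ∈ frontier R.carrier →
      dist x w ≤ η →
        Metric.infDist x (Q.arc i) < κ + η ∧ 2 * κ - 2 * η < Metric.infDist x (Freeze.otherArcs Q i) := by
    intro i x w hw hwf hxw
    have hκ0 : 0 ≤ κ := by linarith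
    have hwarc : w ∈ R.arc i := Freeze.mem_arc_of_mem_frontier hw hwf (by rw [dist_self]; exact hκ0)
    have h1 : Metric.infDist x (R.arc i) ≤ dist x w := Metric.infDist_le_dist_of_mem hwarc
    have h2 : 2 * κ < Metric.infDist w (Freeze.otherArcs R i) := hw.2
    have h3 : Metric.infDist w (Freeze.otherArcs R i) ≤ Metric.infDist x (Freeze.otherArcs R i) + dist w x :=
      Metric.infDist_le_infDist_add_dist
    rw [dist_comm] at h3
    have h4 := hα i x
    have h5 := hβ i x
    constructor
    · linarith
    · linarith
  -- unpack the event: endpoints `u`, `v` and an open walk `p`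
  obtain ⟨u, hu, v, hv, huv⟩ := h
  rw [mem_openConnIn_iff_exists_openWalk] at huv
  obtain ⟨p, hp⟩ := huv
  set P : Site 2 → ℂ := fun x => (δ : ℂ) * squareLatticeEmbedding.z x with hP
  have hcen : ∀ x : Site 2, P x ∈ Metric.closedBall (P x) ρ := fun x => Metric.mem_closedBall_self hρ
  have hstep : ∀ x y, (openGraph ω).Adj x y → dist (P x) (P y) ≤ Real.sqrt 2 * δ := by
    intro x y hxy
    rw [openGraph_adj] at hxy
    have hadj : (zdGraph 2).Adj x y := by
      have := hω hxy.1
      rwa [SimpleGraph.mem_edgeSet] at this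
    rw [hP, Freeze.dist_z_eq_of_adj hadj, abs_of_pos hδ, mul_comm]
  -- every vertex of the walk is drawn in `Q.carrier` or in a two-radius collar of `Q`
  have hgood : ∀ y ∈ p.support, P y ∈ Q.carrier ∪
      {x | Metric.infDist x (Q.arc 0) < κ + η ∧ 2 * κ - 2 * η < Metric.infDist x (Freeze.otherArcs Q 0)} ∪
      {x | Metric.infDist x (Q.arc 2) < κ + η ∧ 2 * κ - 2 * η < Metric.infDist x (Freeze.otherArcs Q 2)} := by
    intro y hy
    have hball : Metric.closedBall (P y) ρ ⊆ Freeze.enlarge R κ := hp y hy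
    have hPy : P y ∈ Freeze.enlarge R κ := hball (hcen y)
    rcases hPy with (hR | h0) | h2
    · by_cases hfar : ∀ w ∈ frontier R.carrier, η < dist (P y) w
      · exact Or.inl (Or.inl (hdeep _ hR hfar))
      · push Not at hfar
        obtain ⟨w, hwf, hw⟩ := hfar
        have hwball : w ∈ Metric.closedBall (P y) ρ := by
          rw [Metric.mem_closedBall, dist_comm]
          linarith
        have hwR : w ∉ R.carrier := fun hwR => by
          have h' : w ∈ R.carrier ∩ frontier R.carrier := ⟨hwR, hwf⟩
          rw [R.isOpen.inter_frontier_eq] at h'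
          exact Set.notMem_empty w h'
        rcases hball hwball with (h' | h') | h'
        · exact absurd h' hwR
        · exact Or.inl (Or.inr (hnear 0 (P y) w h' hwf hw))
        · exact Or.inr (hnear 2 (P y) w h' hwf hw)
    · exact Or.inl (Or.inr (hcollar 0 _ h0))
    · exact Or.inr (hcollar 2 _ h2)
  -- the endpoints are drawn in the two-radius collars of `Q`, outside `Q.carrier`
  have hout : ∀ (i : Fin 4) (x : Site 2), Metric.closedBall (P x) ρ ⊆ Freeze.sideCollar R i κ \ R.carrier →
      P x ∈ {x | Metric.infDist x (Q.arc i) < κ + η ∧ 2 * κ - 2 * η < Metric.infDist x (Freeze.otherArcs Q i)} \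
        Q.carrier := by
    intro i x hx
    refine ⟨hcollar i _ (hx (hcen x)).1, fun hQ => ?_⟩
    have h1 : Metric.infDist (P x) R.carrier ≤ η := infDist_le_of_mem_cthickening' hη (hcar hQ)
    have h2 : Metric.infDist (P x) R.carrier < ρ := lt_of_le_of_lt h1 hηρ
    rw [Metric.infDist_lt_iff R.nonempty] at h2
    obtain ⟨z, hz, hz'⟩ := h2
    exact (hx (Metric.mem_closedBall.2 (by rw [dist_comm]; exact hz'.le))).2 hz
  -- run extraction (collar-`0` and collar-`2` points are `> κ - 3η ≥ √2 δ` apart; `√2 δ ≤ 2κ - 2η`)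
  have h02 : (0 : Fin 4) ≠ 2 := by decide
  obtain ⟨x, y, q, hq, hx, hy⟩ := exists_crossing_run' P hstep Q
    {x | Metric.infDist x (Q.arc 0) < κ + η ∧ 2 * κ - 2 * η < Metric.infDist x (Freeze.otherArcs Q 0)}
    {x | Metric.infDist x (Q.arc 2) < κ + η ∧ 2 * κ - 2 * η < Metric.infDist x (Freeze.otherArcs Q 2)}
    (fun x hx y hy => by
      have := lt_dist_of_near_of_far h02 hx.1 hy.2
      linarith)
    (fun x hx hx' => not_far_of_near h02 (by linarith) hx.1 hx'.2)
    (fun x hx w hw hd => mem_arc_of_mem_frontier' hx.2 hw (hd.trans (by linarith)))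
    (fun x hx w hw hd => mem_arc_of_mem_frontier' hx.2 hw (hd.trans (by linarith)))
    p (hout 0 u hu) (hout 2 v hv) hgood
  unfold crossEvent
  refine ⟨x, hx.trans h2le, y, hy.trans h2le, ?_⟩
  rw [mem_openConnIn_iff_exists_openWalk]
  exact ⟨q, hq⟩

end Summit.CriticalPhenomena.CardyFormulaZ2.Cruxes.UniformMarginality.HeatFlow

end
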